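import Summits.AtomisticToContinuum.Crystallization.Theorems.ExcessDecayLiouvilleHcpLiouvilleBlowdownDefs

/-!
# `ExcessDecayLiouville.HcpLiouville` (stmt-AtomisticToContinuum-9332), line `Sketch` (skeleton v4): arithmetic of the Caccioppoli levels

Helper for stub `stub_interior` (step (4) of the interior estimate for `L`-harmonic fields): the pure real-number
bookkeeping that turns the output of one Caccioppoli level (`blowdown_levelStep`, radii `δ = R/40`, `ρK ≤ R/2`,
support radius `R₀ ≤ R`, balancing parameter `μ = R⁻ᵏ`) at difference level `k ≤ 3` into the scale-invariant form
`E_k ≤ A·K·R^{-(2k+2)}·W`, given the inputs of the level in the same form: the mass on the Caccioppoli ball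
`M′ ≤ a R^{-2k} W`, the total mass `M ≤ 4ᵏ W`, and the forcing `R⁵ Γ ≤ g R^{-(2k+2)} W` (`blowdown_levelArith`,
registered).  Here `W = osc + Y₀² R⁻¹ + Y₂² R⁻³` in the assembly.
All `[folklore]`; a `--supports` helper for item stmt-AtomisticToContinuum-9332, nothing here closes an item.
-/

noncomputable section

namespace Summit.AtomisticToContinuum.Crystallization.Theorems.ExcessDecayLiouville

open scoped BigOperators Topology Classical

namespace Blowdown

/-- Powers of `R⁻¹` absorb powers of `R`: `(R⁻¹)⁸ R³ = (R⁻¹)⁵` and `Rᵏ (R⁻¹)ᵏ = 1`. [folklore] -/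
theorem inv_pow_mul_pow {R : ℝ} (hR : 0 < R) (k : ℕ) :
    (R⁻¹) ^ 8 * R ^ 3 = (R⁻¹) ^ 5 ∧ R ^ k * (R⁻¹) ^ k = 1 := by
  have hR0 : R ≠ 0 := hR.ne'
  constructor
  · field_simp
  · rw [← mul_pow, mul_inv_cancel₀ hR0, one_pow]

/-- **Arithmetic of one Caccioppoli level** at difference level `k ≤ 3` (see the module docstring). [folklore] -/
theorem level_arith {K R W E M M' Γ ρK R₀ a g : ℝ} {k : ℕ} (hk : k ≤ 3) (hR : 1 ≤ R) (hK : 0 ≤ K) (hW : 0 ≤ W)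
    (ha : 0 ≤ a) (hg : 0 ≤ g) (hM'0 : 0 ≤ M') (hM' : M' ≤ a * (R⁻¹) ^ (2 * k) * W) (hM0 : 0 ≤ M)
    (hM : M ≤ 4 ^ k * W) (hΓ0 : 0 ≤ Γ) (hΓ : R ^ 5 * Γ ≤ g * (R⁻¹) ^ (2 * k + 2) * W)
    (hρK0 : 0 ≤ ρK) (hρK : ρK ≤ R / 2) (hR₀0 : 0 ≤ R₀) (hR₀ : R₀ ≤ R)
    (hE : E ≤ K * (((R / 40)⁻¹) ^ 2 * M' + (R / 40) ^ 2 * ρK ^ 3 * Γ +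
      ((R / 40)⁻¹) ^ 8 * ((R⁻¹) ^ k * R₀ ^ 3 * M + ((R⁻¹) ^ k)⁻¹ * ρK ^ 3 * M'))) :
    E ≤ (1600 * a + g + 40 ^ 8 * (4 ^ k + a)) * K * (R⁻¹) ^ (2 * k + 2) * W := by
  have hR0 : 0 < R := by linarith
  have hu0 : 0 ≤ R⁻¹ := by positivity
  have hu1 : R⁻¹ ≤ 1 := inv_le_one_of_one_le₀ hR
  have hinv : (R / 40)⁻¹ = 40 * R⁻¹ := by rw [inv_div]; ring
  obtain ⟨h83, hkk⟩ := inv_pow_mul_pow hR0 k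
  set u := R⁻¹ with hu
  have hupow : ∀ {i j : ℕ}, i ≤ j → u ^ j ≤ u ^ i := fun h => pow_le_pow_of_le_one hu0 hu1 h
  rw [hinv] at hE
  -- term 1
  have T1 : (40 * u) ^ 2 * M' ≤ 1600 * a * u ^ (2 * k + 2) * W := by
    calc (40 * u) ^ 2 * M' ≤ (40 * u) ^ 2 * (a * u ^ (2 * k) * W) := mul_le_mul_of_nonneg_left hM' (by positivity)
      _ = 1600 * a * u ^ (2 * k + 2) * W := by ring
  -- term 2
  have T2 : (R / 40) ^ 2 * ρK ^ 3 * Γ ≤ g * u ^ (2 * k + 2) * W := by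
    have h1 : ρK ^ 3 ≤ (R / 2) ^ 3 := pow_le_pow_left₀ hρK0 hρK 3
    calc (R / 40) ^ 2 * ρK ^ 3 * Γ ≤ (R / 40) ^ 2 * (R / 2) ^ 3 * Γ := by gcongr
      _ = R ^ 5 * Γ / 12800 := by ring
      _ ≤ g * u ^ (2 * k + 2) * W / 12800 := by gcongr
      _ ≤ g * u ^ (2 * k + 2) * W := by
          have : 0 ≤ g * u ^ (2 * k + 2) * W := by positivity
          linarith
  -- term 3
  have T3 : (40 * u) ^ 8 * (u ^ k * R₀ ^ 3 * M) ≤ 40 ^ 8 * 4 ^ k * u ^ (2 * k + 2) * W := by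
    have h1 : R₀ ^ 3 ≤ R ^ 3 := pow_le_pow_left₀ hR₀0 hR₀ 3
    have h2 : u ^ 8 * R ^ 3 = u ^ 5 := h83
    calc (40 * u) ^ 8 * (u ^ k * R₀ ^ 3 * M) ≤ (40 * u) ^ 8 * (u ^ k * R ^ 3 * (4 ^ k * W)) := by gcongr
      _ = 40 ^ 8 * 4 ^ k * (u ^ k * (u ^ 8 * R ^ 3)) * W := by ring
      _ = 40 ^ 8 * 4 ^ k * u ^ (k + 5) * W := by rw [h2, ← pow_add]
      _ ≤ 40 ^ 8 * 4 ^ k * u ^ (2 * k + 2) * W := by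
          have h3 : u ^ (k + 5) ≤ u ^ (2 * k + 2) := hupow (by omega)
          have h4 : 0 ≤ (40 : ℝ) ^ 8 * 4 ^ k := by positivity
          nlinarith [mul_nonneg h4 hW]
  -- term 4
  have T4 : (40 * u) ^ 8 * ((u ^ k)⁻¹ * ρK ^ 3 * M') ≤ 40 ^ 8 * a * u ^ (2 * k + 2) * W := by
    have h1 : ρK ^ 3 ≤ (R / 2) ^ 3 := pow_le_pow_left₀ hρK0 hρK 3
    have hinvk : (u ^ k)⁻¹ = R ^ k := by rw [hu, inv_pow, inv_inv]
    rw [hinvk]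
    have h2 : u ^ 8 * R ^ k * R ^ 3 * u ^ (2 * k) = u ^ (k + 5) := by
      have : u ^ (2 * k) = u ^ k * u ^ k := by rw [← pow_add]; ring_nf
      rw [this]
      calc u ^ 8 * R ^ k * R ^ 3 * (u ^ k * u ^ k) = (u ^ 8 * R ^ 3) * (R ^ k * u ^ k) * u ^ k := by ring
        _ = u ^ (k + 5) := by rw [h83, hkk, mul_one, ← pow_add, add_comm]
    calc (40 * u) ^ 8 * (R ^ k * ρK ^ 3 * M') ≤ (40 * u) ^ 8 * (R ^ k * (R / 2) ^ 3 * (a * u ^ (2 * k) * W)) := by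
          gcongr
      _ = 40 ^ 8 * a / 8 * (u ^ 8 * R ^ k * R ^ 3 * u ^ (2 * k)) * W := by ring
      _ = 40 ^ 8 * a / 8 * u ^ (k + 5) * W := by rw [h2]
      _ ≤ 40 ^ 8 * a * u ^ (2 * k + 2) * W := by
          have h3 : u ^ (k + 5) ≤ u ^ (2 * k + 2) := hupow (by omega)
          have h4 : 0 ≤ (40 : ℝ) ^ 8 * a := by positivity
          have h5 : 0 ≤ u ^ (k + 5) := by positivity
          nlinarith [mul_nonneg h4 hW, mul_nonneg (mul_nonneg h4 hW) h5]
  calc E ≤ _ := hE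
    _ ≤ K * (1600 * a * u ^ (2 * k + 2) * W + g * u ^ (2 * k + 2) * W +
        (40 ^ 8 * 4 ^ k * u ^ (2 * k + 2) * W + 40 ^ 8 * a * u ^ (2 * k + 2) * W)) := by
        refine mul_le_mul_of_nonneg_left ?_ hK
        rw [mul_add ((40 * u) ^ 8)]
        exact add_le_add (add_le_add T1 T2) (add_le_add T3 T4)
    _ = (1600 * a + g + 40 ^ 8 * (4 ^ k + a)) * K * u ^ (2 * k + 2) * W := by ring

end Blowdown

/-- Registered carrier of this helper file (crux stmt-AtomisticToContinuum-9332, line `Sketch` v4, stub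
`stub_interior`, step (4)): the arithmetic of one Caccioppoli level at difference level `k ≤ 3`. [folklore] -/
theorem blowdown_levelArith : ∀ (K R W E M M' Γ ρK R₀ a g : ℝ) (k : ℕ), k ≤ 3 → 1 ≤ R → 0 ≤ K → 0 ≤ W →
    0 ≤ a → 0 ≤ g → 0 ≤ M' → M' ≤ a * (R⁻¹) ^ (2 * k) * W → 0 ≤ M → M ≤ 4 ^ k * W → 0 ≤ Γ →
    R ^ 5 * Γ ≤ g * (R⁻¹) ^ (2 * k + 2) * W → 0 ≤ ρK → ρK ≤ R / 2 → 0 ≤ R₀ → R₀ ≤ R →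
    E ≤ K * (((R / 40)⁻¹) ^ 2 * M' + (R / 40) ^ 2 * ρK ^ 3 * Γ +
      ((R / 40)⁻¹) ^ 8 * ((R⁻¹) ^ k * R₀ ^ 3 * M + ((R⁻¹) ^ k)⁻¹ * ρK ^ 3 * M')) →
    E ≤ (1600 * a + g + 40 ^ 8 * (4 ^ k + a)) * K * (R⁻¹) ^ (2 * k + 2) * W :=
  fun _ _ _ _ _ _ _ _ _ _ _ _ hk hR hK hW ha hg hM'0 hM' hM0 hM hΓ0 hΓ hρK0 hρK hR₀0 hR₀ hE =>
    Blowdown.level_arith hk hR hK hW ha hg hM'0 hM' hM0 hM hΓ0 hΓ hρK0 hρK hR₀0 hR₀ hE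

end Summit.AtomisticToContinuum.Crystallization.Theorems.ExcessDecayLiouville

end
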